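import Literature.Computability.AlgebraicComplexity.CoordRepRational
import Literature.NumberTheory.DiophantineGeometry.GLHighestWeightMultiplicityProofs
import Literature.NumberTheory.DiophantineGeometry.GLHighestWeightExistsUniqueProofs
import HarnessLib

/-!
# Occurrence obstructions: from the weight form to the module form

Topic `Literature/Computability/AlgebraicComplexity`, companion of `GCTObstructions.lean`
(`HasOccurrenceObstruction f g m d`: some irreducible subrepresentation `W` of the degree-`d`
piece `k[Δ_m[g]]_d` of the coordinate ring of the orbit closure of `g` admits no nonzero
intertwiner to `k[Δ_m[f]]_d`). The tree's "no occurrence obstruction" theorems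
(Bürgisser–Ikenmeyer–Panova 2019, Thm. 1.4, files
`Literature/Computability/Complexity/OccurrenceObstructions*.lean`) are stated and PROVED in the
*weight form*: every highest weight `χ` of the upper triangular Borel occurring in `k[Δ_m[g]]`
(`HasHighestWeight (orbitCoordRep g m) χ`) occurs in `k[Δ_m[f]]`. This file proves that the
weight form implies the module form (theorems only, no definitions):

* `not_hasOccurrenceObstruction_of_forall_hasHighestWeight` — in characteristic zero, for
  `m ≠ 0`, if every highest weight of `k[Δ_m[g]]` is a highest weight of `k[Δ_m[f]]`, then
  `¬ HasOccurrenceObstruction f g m d` for every `d`.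

This is the remark of BIP §1(a) ("We say that `λ` occurs in `ℂ[Ω_n]` if it contains [the dual of]
an irreducible `G`-module of type `λ` … Schur's lemma implies that if `λ` occurs in
`ℂ[Z_{n,m}]`, then it must also occur in `ℂ[Ω_n]`") read backwards: an irreducible `W ≤ k[Δ[g]]_d`
is finite-dimensional and rational (`CoordRepRational.lean`), so it has a highest-weight vector
`w` of some weight `χ` (Lie–Kolchin); `χ` then occurs in `k[Δ[f]]`, by a vector `u` which lies in
the degree-`d` piece because *a weight pins the degree*; and a highest-weight vector of weight
`χ` in the completely reducible `k[Δ[f]]_d` is the image of `w` under an intertwiner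
`W → k[Δ[f]]_d` (theorem of the highest weight), which is therefore nonzero.

## Contents

* §1 The degree pieces `k[Δ_m[f]]_d` are finite-dimensional, and a weight pins the degree: a
  highest-weight vector of `k[Δ_m[f]]` of weight `χ` lies in the piece of degree `D` with
  `|χ| = -m D` (`mem_orbitCoordRingDeg_of_mem_highestWeightSpace`), and a nonzero one in the
  degree-`d` piece has `|χ| = -m d` (`size_eq_of_mem_orbitCoordRingDeg_of_mem_highestWeightSpace`);
  both from the torus-weight decomposition of representatives
  (`sum_filter_monWeight_mem_orbitVanishingIdeal`, `size_monWeight`).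
* §2 The bridge `not_hasOccurrenceObstruction_of_forall_hasHighestWeight`.

## Sources

* P. Bürgisser, C. Ikenmeyer, G. Panova, *No occurrence obstructions in geometric complexity
  theory*, J. AMS 32 (2019) 163–193 = arXiv:1604.06431v3, §1(a) (occurrence, the restriction
  epimorphism and Schur's lemma; "occurrence obstructions `λ` must satisfy `|λ| = nd`").
  [BurgisserIkenmeyerPanovaJAMS2019]
* R. Goodman, N. Wallach, *Symmetry, Representations, and Invariants*, GTM 255 (2009),
  Cor. 3.2.3 (existence of highest weights), §4.1.6 with Thm. 4.2.12 (multiplicity and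
  highest-weight vectors). [GoodmanWallachGTM255]
* P. Bürgisser, J. M. Landsberg, L. Manivel, J. Weyman, SIAM J. Comput. 40 (2011), §4.4, §5.2
  (a weight pins the degree; coordinate rings of orbit closures as `GL`-modules).
  [BurgisserEtAl2011]

## Mathlib and tree

Mathlib: `Representation.IsIrreducible`, `Subrepresentation`, `Representation.IntertwiningMap`,
`MvPolynomial.IsHomogeneous`. Tree: `orbitCoordRingDeg`, `orbitCoordSubrep`, `orbitCoordRepDeg`,
`HasOccurrenceObstruction` (`GCTObstructions.lean`); `isRationalRep_orbitCoordRep`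
(`CoordRepRational.lean`); `finite_homogeneousSubmodule` (`MultiplicityObstructionsProofs.lean`);
`monWeight`, `size_monWeight` (`OrbitClosureWeights.lean`);
`sum_filter_monWeight_mem_orbitVanishingIdeal` (`SchurWeylPlethysmOrbitWeightsProofs.lean`);
`highestWeightSpace`, `HasHighestWeight` (`GLHighestWeight.lean`);
`exists_hasHighestWeight_of_isRationalRep` (`GLHighestWeightExistsUniqueProofs.lean`);
`IsRationalRep.toRepresentation`, `mem_highestWeightSpace_toRepresentation_iff`,
`exists_intertwiningMap_apply_eq` (`GLHighestWeightMultiplicityProofs.lean`). Nothing is restated;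
no new definitions.

## Design

Variables as in `GLHighestWeight.lean`: `[Fintype σ] [LinearOrder σ] [Field k]`. §1 holds over
an infinite field, §2 in characteristic zero (complete reducibility enters through
`exists_intertwiningMap_apply_eq`). The specialisations to the determinant and the padded
permanents (discharges of `bip2019_not_hasOccurrenceObstruction` and
`bip_no_occurrence_obstruction_succ`) live in
`Literature/Computability/Complexity/OccurrenceObstructionsModuleForm.lean`.
-/

noncomputable section

open scoped BigOperators Matrix

namespace Literature.Computability.AlgebraicComplexity

open MvPolynomial Literature.NumberTheory.DiophantineGeometry

/-! ### §1 Degree pieces: finite-dimensionality, and a weight pins the degree -/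

section Degrees

variable {σ : Type*} [Fintype σ] [LinearOrder σ] {k : Type*} [Field k]

/-- The degree-`d` piece `k[Δ_m[f]]_d` is finite-dimensional: it is the image of the forms of
degree `d` in finitely many coordinates (`finite_homogeneousSubmodule`). BLMW 2011 §5.2
(degreewise finite-dimensional coordinate rings). [folklore] -/
theorem finiteDimensional_orbitCoordRingDeg (f : MvPolynomial σ k) (m d : ℕ) :
    FiniteDimensional k (orbitCoordRingDeg f m d) := by
  haveI : Module.Finite k (homogeneousSubmodule (DegIdx σ m) k d) :=
    finite_homogeneousSubmodule _ _ _
  unfold orbitCoordRingDeg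
  infer_instance

/-- A representative `F` of a `B`-semi-invariant class of weight `χ` in `k[Δ_m[f]]` is
semi-invariant of weight `χ` modulo the vanishing ideal: `b · F - χ(b) F ∈ I(GL · f)` for every
upper triangular `b`. Unfolding of `highestWeightSpace (orbitCoordRep f m)`. [folklore] -/
theorem coordSubst_sub_smul_mem_of_mem_highestWeightSpace {f : MvPolynomial σ k} {m : ℕ}
    {χ : Weight σ} {F : MvPolynomial (DegIdx σ m) k}
    (hx : Ideal.Quotient.mk (orbitVanishingIdeal f m) F ∈
      highestWeightSpace (orbitCoordRep f m) χ)
    (b : GL σ k) (hb : IsUpperTriangular b) :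
    coordSubst m b F - weightChar χ b • F ∈ orbitVanishingIdeal f m := by
  rw [← Ideal.Quotient.eq]
  have h := hx b hb
  rw [orbitCoordRep_apply, orbitCoordSubst_mk] at h
  rw [h]
  exact (map_smul (Ideal.Quotient.mkₐ k (orbitVanishingIdeal f m)) (weightChar χ b) F).symm

/-- **A torus semi-invariant class is the class of its part of that torus weight.** If `F` is
semi-invariant of weight `χ` under the diagonal torus modulo `I(GL · f)` (infinite field), then
`F` minus the sum of its monomials of torus weight `χ` lies in `I(GL · f)`: the parts of the other
weights do (`sum_filter_monWeight_mem_orbitVanishingIdeal`, independence of characters). This is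
the argument of `finiteDimensional_highestWeightSpace_orbitCoordRep_holds`, isolated.
BLMW 2011 §5.2. [cite: BurgisserEtAl2011, §5.2] -/
theorem sub_sum_filter_monWeight_mem_orbitVanishingIdeal [Infinite k] (f : MvPolynomial σ k)
    {m : ℕ} {χ : Weight σ} {F : MvPolynomial (DegIdx σ m) k}
    (hF : ∀ t : GL σ k, IsDiagonalGL t →
      coordSubst m t F - weightChar χ t • F ∈ orbitVanishingIdeal f m) :
    F - ∑ s ∈ F.support.filter (fun s => monWeight s = χ), monomial s (coeff s F) ∈
      orbitVanishingIdeal f m := by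
  classical
  set W : Finset (Weight σ) := insert χ (F.support.image monWeight) with hW
  have hmaps : ∀ s ∈ F.support, monWeight s ∈ W := fun s hs =>
    Finset.mem_insert_of_mem (Finset.mem_image_of_mem _ hs)
  have hFsum : F = ∑ v ∈ W, ∑ s ∈ F.support.filter (fun s => monWeight s = v),
      monomial s (coeff s F) := by
    conv_lhs => rw [← F.support_sum_monomial_coeff]
    exact (Finset.sum_fiberwise_of_maps_to hmaps _).symm
  have hsplit : F - ∑ s ∈ F.support.filter (fun s => monWeight s = χ), monomial s (coeff s F) =
      ∑ v ∈ W.erase χ, ∑ s ∈ F.support.filter (fun s => monWeight s = v),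
        monomial s (coeff s F) := by
    rw [sub_eq_iff_eq_add, Finset.sum_erase_add _ _ (Finset.mem_insert_self χ _), ← hFsum]
  rw [hsplit]
  exact Ideal.sum_mem _ fun v hv =>
    Literature.NumberTheory.DiophantineGeometry.sum_filter_monWeight_mem_orbitVanishingIdeal f hF
      (Finset.ne_of_mem_erase hv)

/-- **A weight pins the degree.** For `m ≠ 0` over an infinite field, a highest-weight vector of
`k[Δ_m[f]]` of weight `χ` with `|χ| = -m D` lies in the degree-`D` piece `k[Δ_m[f]]_D`: it is the
class of the weight-`χ` part of a representative, all of whose monomials have torus weight `χ`,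
hence (`size_monWeight`: a monomial of degree `e` has weight of size `-m e`) degree `D`.
BLMW 2011 §4.4, §5.2 (the degree `d` is forced by the weight, of size `-d·m`).
[cite: BurgisserEtAl2011, §5.2] -/
theorem mem_orbitCoordRingDeg_of_mem_highestWeightSpace [Infinite k] (f : MvPolynomial σ k)
    {m D : ℕ} (hm : m ≠ 0) {χ : Weight σ} (hχ : χ.size = -((m * D : ℕ) : ℤ))
    {x : OrbitCoordRing f m} (hx : x ∈ highestWeightSpace (orbitCoordRep f m) χ) :
    x ∈ orbitCoordRingDeg f m D := by
  classical
  obtain ⟨F, rfl⟩ := Ideal.Quotient.mk_surjective x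
  have hdiff := sub_sum_filter_monWeight_mem_orbitVanishingIdeal f
    (fun t ht => coordSubst_sub_smul_mem_of_mem_highestWeightSpace hx t ht.isUpperTriangular)
  have heq : Ideal.Quotient.mk (orbitVanishingIdeal f m) F =
      Ideal.Quotient.mk (orbitVanishingIdeal f m)
        (∑ s ∈ F.support.filter (fun s => monWeight s = χ), monomial s (coeff s F)) :=
    Ideal.Quotient.eq.mpr hdiff
  rw [heq]
  refine mem_orbitCoordRingDeg_iff.mpr ⟨_, ?_, rfl⟩
  refine IsHomogeneous.sum _ _ _ fun s hs => isHomogeneous_monomial _ ?_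
  have hw : monWeight s = χ := (Finset.mem_filter.mp hs).2
  have hsize := size_monWeight s
  rw [hw, hχ] at hsize
  have h1 : m * D = m * s.degree := by exact_mod_cast neg_injective hsize
  exact (Nat.eq_of_mul_eq_mul_left (Nat.pos_of_ne_zero hm) h1).symm

/-- **The weight of a nonzero highest-weight vector in the degree-`d` piece has size `-m d`**
(infinite field): the weight-`χ` part of a degree-`d` representative is nonzero, so some monomial
of degree `d` has torus weight `χ`, whose size is `-m d` (`size_monWeight`). BLMW 2011 §4.4,
§5.2; BIP §1(a) ("occurrence obstructions `λ` must satisfy `|λ| = nd`").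
[cite: BurgisserEtAl2011, §5.2] -/
theorem size_eq_of_mem_orbitCoordRingDeg_of_mem_highestWeightSpace [Infinite k]
    (f : MvPolynomial σ k) {m d : ℕ} {χ : Weight σ} {x : OrbitCoordRing f m}
    (hxd : x ∈ orbitCoordRingDeg f m d) (hx : x ∈ highestWeightSpace (orbitCoordRep f m) χ)
    (hx0 : x ≠ 0) : χ.size = -((m * d : ℕ) : ℤ) := by
  classical
  obtain ⟨F, hFd, rfl⟩ := mem_orbitCoordRingDeg_iff.mp hxd
  have hdiff := sub_sum_filter_monWeight_mem_orbitVanishingIdeal f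
    (fun t ht => coordSubst_sub_smul_mem_of_mem_highestWeightSpace hx t ht.isUpperTriangular)
  have heq : Ideal.Quotient.mk (orbitVanishingIdeal f m) F =
      Ideal.Quotient.mk (orbitVanishingIdeal f m)
        (∑ s ∈ F.support.filter (fun s => monWeight s = χ), monomial s (coeff s F)) :=
    Ideal.Quotient.eq.mpr hdiff
  have hne : ∑ s ∈ F.support.filter (fun s => monWeight s = χ), monomial s (coeff s F) ≠ 0 := by
    intro h0
    apply hx0
    rw [heq, h0, map_zero]
  obtain ⟨s, hs⟩ := Finset.nonempty_of_sum_ne_zero hne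
  have hw : monWeight s = χ := (Finset.mem_filter.mp hs).2
  have hsF : s ∈ F.support := (Finset.mem_filter.mp hs).1
  have hdeg : s.degree = d := by
    rw [Finsupp.degree_eq_weight_one]
    exact hFd (mem_support_iff.mp hsF)
  rw [← hw, size_monWeight, hdeg]

end Degrees

/-! ### §2 The bridge: weight form ⇒ module form -/

section Bridge

variable {σ : Type*} [Fintype σ] [LinearOrder σ] {k : Type*} [Field k]

/-- **Weight form ⇒ module form for occurrence obstructions.** In characteristic zero and degree
`m ≠ 0`: if every highest weight (of the upper triangular Borel) occurring in the coordinate ring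
`k[Δ_m[g]]` of the orbit closure of `g` occurs in `k[Δ_m[f]]`, then there is no occurrence
obstruction against `g ∈ Δ_m[f]` in any degree `d` — no irreducible subrepresentation
`W ≤ k[Δ_m[g]]_d` all of whose intertwiners to `k[Δ_m[f]]_d` vanish. Proof: `W` is a
finite-dimensional (`finiteDimensional_orbitCoordRingDeg`) rational
(`isRationalRep_orbitCoordRep`) representation, so it has a highest-weight vector `w` of some
weight `χ` (Lie–Kolchin, `exists_hasHighestWeight_of_isRationalRep`), with `|χ| = -m d`
(`size_eq_of_mem_orbitCoordRingDeg_of_mem_highestWeightSpace`); by hypothesis `χ` occurs in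
`k[Δ_m[f]]`, by a vector `u` lying in the degree-`d` piece
(`mem_orbitCoordRingDeg_of_mem_highestWeightSpace`); and in the completely reducible rational
representation `k[Δ_m[f]]_d` the highest-weight vector `u` is `ψ(w)` for an intertwiner
`ψ : W → k[Δ_m[f]]_d` (`exists_intertwiningMap_apply_eq`, theorem of the highest weight), which is
therefore nonzero. This is the equivalence, asserted in BIP §1(a) via complete reducibility and
Schur's lemma, between "`λ` occurs" (an irreducible of type `λ` is contained) and the existence
of a highest-weight vector of weight `λ^*`, in the direction the no-go theorem needs.
[cite: BurgisserIkenmeyerPanovaJAMS2019, §1(a) (occurrence; restriction epimorphism and Schur's lemma)] -/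
theorem not_hasOccurrenceObstruction_of_forall_hasHighestWeight [CharZero k]
    {f g : MvPolynomial σ k} {m : ℕ} (hm : m ≠ 0)
    (H : ∀ χ : Weight σ, HasHighestWeight (orbitCoordRep g m) χ →
      HasHighestWeight (orbitCoordRep f m) χ) (d : ℕ) :
    ¬ HasOccurrenceObstruction f g m d := by
  rintro ⟨W, hWd, hWirr, hW0⟩
  haveI := hWirr
  haveI : FiniteDimensional k (orbitCoordRingDeg g m d) := finiteDimensional_orbitCoordRingDeg g m d
  haveI : FiniteDimensional k (orbitCoordRingDeg f m d) := finiteDimensional_orbitCoordRingDeg f m d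
  haveI : FiniteDimensional k W.toSubmodule := Submodule.finiteDimensional_of_le hWd
  haveI : Nontrivial W.toSubmodule := by
    by_contra hV
    rw [not_nontrivial_iff_subsingleton] at hV
    exact (bot_ne_top : (⊥ : Subrepresentation W.toRepresentation) ≠ ⊤)
      (Subrepresentation.toSubmodule_injective (Subsingleton.elim _ _))
  have hWrat : IsRationalRep W.toRepresentation :=
    (isRationalRep_orbitCoordRep g m).toRepresentation W
  -- a highest-weight vector of `W`
  obtain ⟨χ, hχ⟩ := exists_hasHighestWeight_of_isRationalRep W.toRepresentation hWrat
  obtain ⟨w, hw0, hw⟩ := (hasHighestWeight_iff_exists _ _).mp hχ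
  have hw' : (w : OrbitCoordRing g m) ∈ highestWeightSpace (orbitCoordRep g m) χ :=
    (mem_highestWeightSpace_toRepresentation_iff W χ w).mp hw
  have hw0' : (w : OrbitCoordRing g m) ≠ 0 := fun h => hw0 (Subtype.ext h)
  -- its weight is pinned to the degree `d`
  have hsize := size_eq_of_mem_orbitCoordRingDeg_of_mem_highestWeightSpace g (hWd w.2) hw' hw0'
  -- the weight occurs in `k[Δ[f]]`, in degree `d`
  obtain ⟨u, hu0, hu⟩ := (hasHighestWeight_iff_exists _ _).mp
    (H χ ((hasHighestWeight_iff_exists _ _).mpr ⟨w, hw0', hw'⟩))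
  have hud : u ∈ orbitCoordRingDeg f m d :=
    mem_orbitCoordRingDeg_of_mem_highestWeightSpace f hm hsize hu
  set u' : orbitCoordRingDeg f m d := ⟨u, hud⟩ with hu'def
  have hu' : u' ∈ highestWeightSpace (orbitCoordRepDeg f m d) χ :=
    (mem_highestWeightSpace_toRepresentation_iff (orbitCoordSubrep f m d) χ u').mpr hu
  have hu'0 : u' ≠ 0 := fun h => hu0 (congrArg Subtype.val h)
  have hfrat : IsRationalRep (orbitCoordRepDeg f m d) :=
    (isRationalRep_orbitCoordRep f m).toRepresentation (orbitCoordSubrep f m d)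
  -- a nonzero intertwiner `W → k[Δ[f]]_d`
  obtain ⟨ψ, hψ⟩ := exists_intertwiningMap_apply_eq hWrat hw hw0 hfrat hu' hu'0
  rw [hW0 ψ] at hψ
  exact hu'0 hψ.symm

end Bridge

end Literature.Computability.AlgebraicComplexity
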